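import Summits.Ventures.YMGap.YM3IR.DecayTransferProof
import HarnessLib

/-!
# YM₃ infrared statement — `DecayTransfer` with NO side conditions (every `ρ`, every sign of the rates)

HONEST FRAMING.  Bookkeeping complement to `YM3IR/DecayTransferProof.lean` (cell `pub-ymgap`, track Y4; seat ds-1): the
support predicate `YM3IR.DecayTransfer r ρ W I m_c κ` of `YM3IR/Statement.lean` holds OUTRIGHT — for every representation
`ρ` (continuous or not) and all real `κ, m_c` — so that `T_IR mk B r ρ I C_b κ m_c` follows from the quotable conjecture
`IRConjecture3 B r ρ I C_b κ` with no hypothesis at all (`t_IR_of_irConjecture3'`).  The two removed side conditions are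
degenerate cases: (F1) a torus Wilson measure is a probability measure or the zero measure
(`isProbabilityMeasure_or_eq_zero_wilsonMeasure`: `Z = 0 ⇒ weight = 0`, `Z = ∞ ⇒ Z⁻¹ = 0`); (F2) if `min(m_c, κ) < 0` the
conclusion of `DecayTransfer` is the trivial oscillation bound `|cov(f,g)| ≤ 4D²(Σδf)(Σδg) ≤ 4D²(Σδf)(Σδg)e^{−mn}`
(`clustersWith_of_nonpos`).  Nothing about Yang–Mills is proved here; no axiom, no `sorry`, `0` compute.
-/

noncomputable section

open MeasureTheory ProbabilityTheory Filter Finset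
open Literature.Probability.LatticeModels Literature.Probability.LatticeModels.DobrushinMetric
open Literature.MathematicalPhysics.QuantumLattice Literature.MathematicalPhysics.QuantumFieldTheory

namespace Summit.Ventures.YMGap.YM3IR.DecayTransferProof

variable {G : Type} [MeasurableSpace G] {N : ℕ} [Group G] [TopologicalSpace G] [IsTopologicalGroup G]
  [CompactSpace G] [BorelSpace G]

/-- **(F1)** A torus Wilson measure `Z⁻¹ · e^{−βS} ∏ dU` is a probability measure or the zero measure: if the partition
function `Z` vanishes the weight itself vanishes, if `Z = ∞` then `Z⁻¹ = 0`, and otherwise `Z⁻¹ Z = 1`. (For a continuous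
`ρ` the first case holds: `isProbabilityMeasure_wilsonMeasure`.) [folklore] -/
theorem isProbabilityMeasure_or_eq_zero_wilsonMeasure {d L : ℕ} [NeZero L] (ρ : G →* Matrix (Fin N) (Fin N) ℂ) (β : ℝ) :
    IsProbabilityMeasure (wilsonMeasure (d := d) (L := L) ρ β) ∨ wilsonMeasure (d := d) (L := L) ρ β = 0 := by
  by_cases h0 : partitionFunction (d := d) (L := L) ρ β = 0
  · right
    have hw : wilsonWeight (d := d) (L := L) ρ β = 0 := Measure.measure_univ_eq_zero.1 h0
    rw [wilsonMeasure, hw, smul_zero]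
  · by_cases htop : partitionFunction (d := d) (L := L) ρ β = ⊤
    · right; rw [wilsonMeasure, htop, ENNReal.inv_top, zero_smul]
    · left
      constructor
      simp only [wilsonMeasure, Measure.smul_apply, smul_eq_mul]
      exact ENNReal.inv_mul_cancel h0 htop

omit [TopologicalSpace G] [IsTopologicalGroup G] [CompactSpace G] [BorelSpace G] in
/-- **(F2)** The trivial clustering bound at a nonpositive rate: for a probability (or zero) law `μ`, a link weight `r ≤ D`
and `m ≤ 0`, `ClustersWith r μ (4 (max D 0)²) m` — `cov(f, g) = cov(f − f(U₀), g)` with `|f − f(U₀)| ≤ D₀Σδf` and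
`g ∈ [g(U₀) ∓ D₀Σδg]` (Föllmer's interpolation bound), and `e^{−mn} ≥ 1`. [folklore] -/
theorem clustersWith_of_nonpos {M : ℕ} [NeZero M] {r : G → G → ℝ} {D : ℝ} (hD : ∀ a b, r a b ≤ D)
    (μ : Measure (GaugeConfig 3 M G)) (hP : IsProbabilityMeasure μ ∨ μ = 0) {m : ℝ} (hm : m ≤ 0) :
    ClustersWith r μ (4 * (max D 0) ^ 2) m := by
  classical
  intro f g Δf Δg δf δg n hfm hgm hfd hgd hfb hgb hfl hgl _
  have hSf0 : 0 ≤ ∑ x ∈ Δf, δf x := sum_nonneg fun x _ => hfl.nonneg x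
  have hSg0 : 0 ≤ ∑ y ∈ Δg, δg y := sum_nonneg fun y _ => hgl.nonneg y
  have hD0 : 0 ≤ max D 0 := le_max_right _ _
  have hE1 : 1 ≤ Real.exp (-m * n) := Real.one_le_exp (mul_nonneg (neg_nonneg.2 hm) (Nat.cast_nonneg n))
  have hbase : 0 ≤ 4 * (max D 0) ^ 2 * (∑ x ∈ Δf, δf x) * (∑ y ∈ Δg, δg y) := by positivity
  rcases hP with hPM | hzero
  swap
  · have hcov : cov[f, g; μ] = 0 := by rw [hzero]; simp [covariance]
    rw [hcov, abs_zero]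
    exact hbase.trans (le_mul_of_one_le_right hbase hE1)
  haveI : IsProbabilityMeasure μ := hPM
  set U₀ : GaugeConfig 3 M G := fun _ => 1 with hU₀
  obtain ⟨Cf, hCf⟩ := hfb
  obtain ⟨Cg, hCg⟩ := hgb
  have hfi : Integrable f μ := (memLp_two_of_bound hfm hCf).integrable one_le_two
  have hshift : cov[f, g; μ] = cov[fun U => f U - f U₀, g; μ] := (covariance_sub_const_left hfi (f U₀)).symm
  have hDf : ∀ᵐ U ∂μ, |(fun U => f U - f U₀) U| ≤ max D 0 * ∑ x ∈ Δf, δf x := ae_of_all _ fun U => by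
    have hD' : ∀ a b, r a b ≤ max D 0 := fun a b => (hD a b).trans (le_max_left _ _)
    exact abs_sub_le_mul_sum_of_dependsOn hD' hfd hfl U U₀
  have hgI : ∀ᵐ U ∂μ, g U₀ - max D 0 * ∑ y ∈ Δg, δg y ≤ g U ∧ g U ≤ g U₀ + max D 0 * ∑ y ∈ Δg, δg y :=
    ae_of_all _ fun U => mem_interval_of_isLipBound hD hgd hgl U₀ U
  have h := abs_covariance_le_of_abs_le ((hfm.sub measurable_const).aestronglyMeasurable) hgm.aestronglyMeasurable
    hDf hgI
  rw [hshift]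
  calc |cov[fun U => f U - f U₀, g; μ]|
      ≤ 2 * (max D 0 * ∑ x ∈ Δf, δf x) *
          (g U₀ + max D 0 * ∑ y ∈ Δg, δg y - (g U₀ - max D 0 * ∑ y ∈ Δg, δg y)) := h
    _ = 4 * (max D 0) ^ 2 * (∑ x ∈ Δf, δf x) * (∑ y ∈ Δg, δg y) := by ring
    _ ≤ 4 * (max D 0) ^ 2 * (∑ x ∈ Δf, δf x) * (∑ y ∈ Δg, δg y) * Real.exp (-m * n) :=
        le_mul_of_one_le_right hbase hE1

/-- **`DecayTransfer r ρ W I m_c κ` HOLDS OUTRIGHT** — every representation `ρ`, every block family, every coupling set,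
all real rates: the nonnegative-rate case is `decayTransfer_of` with (F1); if `min(m_c, κ) < 0` the target rate is
negative and (F2) applies. [folklore] -/
theorem decayTransfer_free {ρ : G →* Matrix (Fin N) (Fin N) ℂ} {r : G → G → ℝ} {W : BlockFamily G} {I : Set ℝ}
    {m_c κ : ℝ} : DecayTransfer r ρ W I m_c κ := by
  by_cases hs : 0 ≤ κ ∧ 0 ≤ m_c
  · exact decayTransfer_of (fun β M _ =>
      isProbabilityMeasure_or_eq_zero_wilsonMeasure (d := 3) (L := W.factor β * M) ρ β) hs.1 hs.2
  · rintro ⟨D, hD⟩ β _ _ _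
    have hmin : min m_c κ ≤ 0 := by
      rcases not_and_or.1 hs with h | h
      · exact (min_le_right _ _).trans (le_of_lt (not_le.1 h))
      · exact (min_le_left _ _).trans (le_of_lt (not_le.1 h))
    have hb : (0 : ℝ) ≤ 3 * (W.factor β : ℝ) := by positivity
    have hm : min m_c κ / (3 * (W.factor β : ℝ)) ≤ 0 := div_nonpos_of_nonpos_of_nonneg hmin hb
    exact ⟨4 * (max D 0) ^ 2, fun M _ _ => clustersWith_of_nonpos hD _
      (isProbabilityMeasure_or_eq_zero_wilsonMeasure (d := 3) (L := W.factor β * M) ρ β) hm⟩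

/-- **`T_IR` from the quotable conjecture, no side conditions**: `IRConjecture3 B r ρ I C_b κ → T_IR mk B r ρ I C_b κ m_c`.
[folklore] -/
theorem t_IR_of_irConjecture3' {L : ℕ} {B : BallSpec G N} {r : G → G → ℝ} {ρ : G →* Matrix (Fin N) (Fin N) ℂ}
    {I : Set ℝ} {C_b κ m_c : ℝ} (mk : Balaban1985CMP102.Theorems.Construction L) (h : IRConjecture3 B r ρ I C_b κ) :
    T_IR mk B r ρ I C_b κ m_c :=
  t_IR_of_conjecture mk h fun _ => decayTransfer_free

/-- **The composition from `IRConjecture3` without the continuity hypothesis on `ρ`** (the positivity of the rates and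
of `C_b`, the unbounded coupling set and the bound on `r` are `massGap3Cofinal_of`'s own hypotheses). [folklore] -/
theorem massGap3Cofinal_of_irConjecture3' {L : ℕ} {mk : Balaban1985CMP102.Theorems.Construction L}
    {B : BallSpec G N} {r : G → G → ℝ} {ρ : G →* Matrix (Fin N) (Fin N) ℂ} {I : Set ℝ} {C_b κ m_c : ℝ}
    (hI : ¬ BddAbove I) (hC : 0 < C_b) (hκ : 0 < κ) (hm : 0 < m_c) (hr : ∃ D : ℝ, ∀ a b : G, r a b ≤ D)
    (hUV : BalabanUV3 mk) (hRB : ClusterDomainClustering B r m_c) (hIR : IRConjecture3 B r ρ I C_b κ) :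
    MassGap3Cofinal I r ρ :=
  massGap3Cofinal_of hI hC hκ hm hr hUV hRB (t_IR_of_irConjecture3' mk hIR)

end Summit.Ventures.YMGap.YM3IR.DecayTransferProof

end
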